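import Literature.Computability.AlgebraicComplexity.TangencyFlattening
import HarnessLib

/-!
# The reach of tangency-flattening certificates when two factors have dimension `≤ 9`: at most `R̲ ≥ 17`, and at most `R̲ ≥ 11` in the native `9 × 9 × 9` format

Topic `Literature/Computability/AlgebraicComplexity`. Theorems only (no definitions, no named facts).

Doležálek–Michałek (arXiv:2602.12762, 2026) introduce the **tangency flattening**
`Tang(t) : Λ³V₁* ⊗ V₂* ⊗ V₃* → V₁* ⊗ V₂ ⊗ V₃` of a tensor `t ∈ V₁ ⊗ V₂ ⊗ V₃`, a matrix depending
QUADRATICALLY on `t`, and prove (Cor. 3.9, from Thm. 3.3 / Cor. 3.5): if `dim V₁ = dim V₂ = dim V₃ = n`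
then the `(q(q−1)(n−2) + 1)`-minors of `Tang` are equations for border rank `≤ q`; its minors are the
first explicit determinantal equations vanishing on secant varieties but not on cactus varieties
(Thm. 1.1, `n ≥ 14`), and they reprove `R̲(M⟨2⟩) = 7` (Prop. 5.1: `rank Tang(M⟨2⟩) = 64 > 60`). About
larger matrix multiplication tensors the paper says only (§6.3): "We did not extensively check all
our equations on these examples, noting that for `M₂` our equations certainly provide a new approach."
The tree proves Cor. 3.9 in every format over every field for the algebraic border rank
(`TangencyFlattening.lean`: `rank_tangencyFlattening_le : rank Tang(t) ≤ R̲(t)(R̲(t)−1)(|ι|−2)`, and the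
certificate form `le_algBorderRank_of_lt_rank_tangencyFlattening :
(R−1)(R−2)(|ι|−2) < rank Tang(t) → R ≤ R̲(t)`).

This file records, by counting columns, how far that ONE certificate shape can reach when the two
non-exterior factors have dimension `≤ 9` — the situation of `⟨3,3,3⟩ ∈ K⁹ ⊗ K⁹ ⊗ K⁹` (printed window
`17 ≤ R̲(M⟨3⟩) ≤ 20`, CHL 2023 Thm. 1.1 / Smirnov 2013) and of every image of it under linear maps on
the factors. `Tang(t)` has `|ι|·|κ|·|μ| ≤ 81·|ι|` columns, so `rank Tang(t) ≤ 81·|ι|`, while the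
certificate for `R` needs `rank Tang(t) > (R−1)(R−2)(|ι|−2)`:

* `not_tangencyCertificate_of_eighteen_le` — for `R ≥ 18` (and `|κ|, |μ| ≤ 9`, ANY `ι`) the hypothesis
  `(R−1)(R−2)(|ι|−2) < rank Tang(t)` is false: `272(|ι|−2) ≥ 81|ι|` once `|ι| ≥ 3`, and for `|ι| ≤ 2`
  the coefficient `|ι| − 2` vanishes, so a positive rank would certify every `R` (impossible, as the
  tree's Cor. 3.9 is a theorem). **So no tangency-flattening certificate gives `R̲ ≥ 18` for any tensor
  whose second and third factors have dimension `≤ 9`, in particular for no projection of `⟨3,3,3⟩`.**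
  (The formal maximum `17` is attained only at `|ι| = 3`: `16·15·1 = 240 < 243 = 3·81`.)
* `not_tangencyCertificate_of_twelve_le` — in the native cube-like range `|ι| ≥ 8` (`|κ|, |μ| ≤ 9`)
  already `R ≥ 12` is out of reach (`110(|ι|−2) ≥ 81|ι|` iff `29|ι| ≥ 220`): on `K⁹ ⊗ K⁹ ⊗ K⁹` itself the
  tangency flattening cannot even reproduce Strassen's `R̲(M⟨3⟩) ≥ 14`.
* `not_tangencyCertificate_matMulTensor_three_of_twelve_le` — the instance `t = ⟨3,3,3⟩`.

HONEST FRAMING: a limitation of one certificate shape (the tangency flattening with the bound of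
Cor. 3.9, read through `(R−1)(R−2)(|ι|−2)`), proved by counting columns; it says nothing about the
other Kronecker–Koszul / Kronecker–Young flattenings of the paper (Thm. 3.3 with other data), nothing
about border apolarity, and nothing about `R̲(⟨3,3,3⟩)` itself. Companion file for the classical Koszul
flattenings: `KoszulFlatteningCeiling.lean` (reach `17` when a factor has dimension `≤ 9`).

## References

* [DolezalekMichalek2026] M. Doležálek, M. Michałek, *Nonlinear methods for tensors: determinantal
  equations for secant varieties beyond cactus*, arXiv:2602.12762 (2026) — Thm. 3.3, Cor. 3.5, Cor. 3.9
  (the bound), Prop. 5.1 (`M₂`), §6.3 (larger matrix multiplication not checked).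
* [ConnerHarperLandsberg2023] A. Conner, A. Harper, J. M. Landsberg, Forum Math. Pi 11 (2023) e17 —
  Thm. 1.1 (`R̲(M⟨3⟩) ≥ 17`).
-/

namespace Literature.Computability.AlgebraicComplexity

open Matrix

universe u v₀ v₁ v₂

section Ceiling

variable {K : Type u} [Field K] {ι : Type v₀} {κ : Type v₁} {μ : Type v₂}
variable [DecidableEq ι] [Fintype ι] [Fintype κ] [Fintype μ]

/-- **Column count**: the tangency flattening has `|ι|·|κ|·|μ|` columns, so when `|κ|, |μ| ≤ 9` its rank
is at most `81·|ι|`. [cite: DolezalekMichalek2026, §3 (before Cor 3.9: the map Λ³V₁*⊗V₂*⊗V₃* → V₁*⊗V₂⊗V₃)] -/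
theorem rank_tangencyFlattening_le_eightyone_mul_card (hκ : Fintype.card κ ≤ 9)
    (hμ : Fintype.card μ ≤ 9) (t : ι → κ → μ → K) :
    (tangencyFlattening t).rank ≤ 81 * Fintype.card ι := by
  have hw := Matrix.rank_le_card_width (tangencyFlattening t)
  rw [Fintype.card_prod, Fintype.card_prod] at hw
  calc (tangencyFlattening t).rank
      ≤ Fintype.card ι * (Fintype.card κ * Fintype.card μ) := hw
    _ ≤ Fintype.card ι * (9 * 9) := Nat.mul_le_mul_left _ (Nat.mul_le_mul hκ hμ)
    _ = 81 * Fintype.card ι := by ring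

/-- When the exterior factor has dimension `≤ 2` the tangency flattening certifies nothing: a positive
rank would, through Cor. 3.9 (whose coefficient `|ι| − 2` then vanishes), bound the border rank from
below by every integer. [cite: DolezalekMichalek2026, Cor 3.9] -/
theorem rank_tangencyFlattening_eq_zero_of_card_le_two [DecidableEq κ] [DecidableEq μ]
    (hι : Fintype.card ι ≤ 2)
    (t : ι → κ → μ → K) : (tangencyFlattening t).rank = 0 := by
  by_contra h
  have hpos : 0 < (tangencyFlattening t).rank := Nat.pos_of_ne_zero h
  have h0 : Fintype.card ι - 2 = 0 := by omega
  have key := le_algBorderRank_of_lt_rank_tangencyFlattening t (R := algBorderRank t + 1)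
    (by rw [h0, Nat.mul_zero]; exact hpos)
  omega

/-- **Tangency-flattening certificates stop at `17` when the other two factors have dimension `≤ 9`**:
for `R ≥ 18` (and `|κ|, |μ| ≤ 9`, any exterior factor `ι`) the hypothesis
`(R − 1)(R − 2)(|ι| − 2) < rank Tang(t)` of `le_algBorderRank_of_lt_rank_tangencyFlattening` is false,
whatever the field and the tensor `t` — so for no image of a tensor in `K⁹ ⊗ K⁹ ⊗ K⁹` under linear maps
on the factors. [cite: DolezalekMichalek2026, Cor 3.9]
[cite: ConnerHarperLandsberg2023, Thm. 1.1] -/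
theorem not_tangencyCertificate_of_eighteen_le [DecidableEq κ] [DecidableEq μ]
    (hκ : Fintype.card κ ≤ 9) (hμ : Fintype.card μ ≤ 9) (t : ι → κ → μ → K) {R : ℕ} (hR : 18 ≤ R) :
    ¬ ((R - 1) * (R - 2) * (Fintype.card ι - 2) < (tangencyFlattening t).rank) := by
  intro h
  by_cases hι : Fintype.card ι ≤ 2
  · rw [rank_tangencyFlattening_eq_zero_of_card_le_two hι t] at h
    exact Nat.not_lt_zero _ h
  · push Not at hι
    have hcol := rank_tangencyFlattening_le_eightyone_mul_card hκ hμ t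
    -- `(R-1)(R-2) ≥ 17·16 = 272` and `272 (|ι| - 2) ≥ 81 |ι|` for `|ι| ≥ 3`
    have hmono : 17 * 16 * (Fintype.card ι - 2) ≤ (R - 1) * (R - 2) * (Fintype.card ι - 2) :=
      Nat.mul_le_mul_right _ (Nat.mul_le_mul (by omega) (by omega))
    have hcnt : 81 * Fintype.card ι ≤ 17 * 16 * (Fintype.card ι - 2) := by omega
    omega

/-- **In the cube-like range `|ι| ≥ 8` (and `|κ|, |μ| ≤ 9`) already `R ≥ 12` is out of reach**:
`(R − 1)(R − 2)(|ι| − 2) ≥ 110(|ι| − 2) ≥ 81|ι| ≥ rank Tang(t)`. On `K⁹ ⊗ K⁹ ⊗ K⁹` the tangency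
flattening therefore cannot certify more than `R̲ ≥ 11` for any tensor.
[cite: DolezalekMichalek2026, Cor 3.9] -/
theorem not_tangencyCertificate_of_twelve_le (hι : 8 ≤ Fintype.card ι) (hκ : Fintype.card κ ≤ 9)
    (hμ : Fintype.card μ ≤ 9) (t : ι → κ → μ → K) {R : ℕ} (hR : 12 ≤ R) :
    ¬ ((R - 1) * (R - 2) * (Fintype.card ι - 2) < (tangencyFlattening t).rank) := by
  intro h
  have hcol := rank_tangencyFlattening_le_eightyone_mul_card hκ hμ t
  have hmono : 11 * 10 * (Fintype.card ι - 2) ≤ (R - 1) * (R - 2) * (Fintype.card ι - 2) :=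
    Nat.mul_le_mul_right _ (Nat.mul_le_mul (by omega) (by omega))
  have hcnt : 81 * Fintype.card ι ≤ 11 * 10 * (Fintype.card ι - 2) := by omega
  omega

end Ceiling

/-- **The instance `⟨3,3,3⟩`** (`ι = κ = μ = Fin 3 × Fin 3`, all of cardinality `9`): the tangency
flattening of `matMulTensor K 3 3 3` (a `9⁵ × 729` matrix) satisfies the certificate hypothesis of
Cor. 3.9 for no `R ≥ 12`, over any field; the printed `R̲(M⟨3⟩) ≥ 17` (CHL 2023, Thm. 1.1) comes from
border apolarity, and Doležálek–Michałek do not apply their flattenings to `M⟨3⟩` (§6.3).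
[cite: DolezalekMichalek2026, Cor 3.9 and §6.3] [cite: ConnerHarperLandsberg2023, Thm. 1.1] -/
theorem not_tangencyCertificate_matMulTensor_three_of_twelve_le (K : Type u) [Field K] {R : ℕ}
    (hR : 12 ≤ R) :
    ¬ ((R - 1) * (R - 2) * (Fintype.card (Fin 3 × Fin 3) - 2) <
        (tangencyFlattening (matMulTensor K 3 3 3)).rank) :=
  not_tangencyCertificate_of_twelve_le (by simp) (by simp) (by simp) (matMulTensor K 3 3 3) hR

end Literature.Computability.AlgebraicComplexity
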